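import Literature.Topology.FourManifolds.FishtailTubeForms
import Literature.Topology.FourManifolds.GompfFramedTwistOfTubeModel
import HarnessLib

/-!
# The tube of the fishtail disc over the fibre `s = 1/2`

Infrastructure for the explicit fishtail neighbourhood (R. Gompf, *More Cappell–Shaneson spheres
are standard*, Algebr. Geom. Topol. 10 (2010), proof of Lemma 2.2; the named fact
`Literature.Topology.FourManifolds.gompf2010_framedTwist`). The support of Gompf's fishtail
diffeomorphism has to lie in the twisted cylinder neighbourhood
`twistNbhd ψ 1 (axisTube r)`, which contains every point of the mapping torus except the points
`[x, 1/2]` of the fibre over `1/2` with `x` off the axis tube. We record, zone by zone, that every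
old point of the tube `T.tubeD (ζ, w)` of the concrete data whose representative lies over
`s = 1/2` has its `T³`-coordinate in the axis tube (`hole_tn`): only the `D⁰` zones reach the fibre
over `1/2`, and there the fibre angles are `λ a`, `κ a`, `-κ b`, `-λ b` (the winding sections
vanish over `s = 1/2`).

Everything is proved; no named facts.

## References

* R. E. Gompf, *More Cappell–Shaneson spheres are standard*, Algebr. Geom. Topol. 10 (2010)
  1665–1681, Lemma 2.2 (proof). [GompfAGT2010]
-/

noncomputable section

open scoped Real Topology ContDiff Manifold
open Set Filter Complex Metric

namespace Literature.Topology.FourManifolds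

local notation "𝔼 " n:arg => EuclideanSpace ℝ (Fin n)

namespace FP

variable {ε : ℝ} (hε : 0 < ε) (hε2 : ε ≤ 1 / 2) {r : ℝ} (hr : r ≤ π)

/-! ### Points good for the twisted cylinder neighbourhood -/

/-- **An old point is good** for `twistNbhd ψ 1 (axisTube r)`: each of its representatives over
`s = 1/2` has `T³`-coordinate in the axis tube. [folklore] -/
def TNGood (hr : r ≤ π) (m : MTorus tubeShearDiffeo) : Prop :=
  ∀ a : ThreeTorus × ↥mappingTorusPieceOne, (mtGlueData tubeShearDiffeo).inl a = m → (a.2 : ℝ) = 1 / 2 → a.1 ∈ axisTube hr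

/-- A represented point `[X, t]`, `0 < t < 3/2`, is good once `X` is in the tube when `t = 1/2`. [folklore] -/
theorem tnGood_mtPt {X : ThreeTorus} {t : ℝ} (ht0 : 0 < t) (ht1 : t < 3 / 2) (h : t = 1 / 2 → X ∈ axisTube hr) :
    TNGood hr (mtPt tubeShearDiffeo X t) := by
  intro a ha h12
  have ha1 : 0 < (a.2 : ℝ) ∧ (a.2 : ℝ) < 1 := a.2.2
  rw [show (mtGlueData tubeShearDiffeo).inl a = mtPt tubeShearDiffeo a.1 (a.2 : ℝ) from (mtPt_of_mem_one a.1 ha1).symm] at ha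
  by_cases h2 : 1 / 2 < t
  · rcases (mtPt_eq_mtPt_iff ha1 ⟨h2, ht1⟩).1 ha with ⟨ht, -⟩ | ⟨ht, -⟩ <;> linarith
  · have h1' : 0 < t ∧ t < 1 := ⟨ht0, by linarith⟩
    obtain ⟨hx, hs⟩ := mtPt_inj_one ha1 h1' ha
    rw [hx]
    exact h (by rw [← hs, h12])

/-- A represented point `[X, t]` with `1/2 < t < 3/2` is good. [folklore] -/
theorem tnGood_mtPt_of_lt {X : ThreeTorus} {t : ℝ} (ht0 : 1 / 2 < t) (ht1 : t < 3 / 2) : TNGood hr (mtPt tubeShearDiffeo X t) :=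
  tnGood_mtPt hr (by linarith) ht1 fun h ↦ absurd h (by linarith)

include hr in
/-- Small exponential vectors in the last two coordinates land in the tube. [folklore] -/
theorem expT_mem_axisTube_of {v : 𝔼 3} (h1 : |v 1| < r) (h2 : |v 2| < r) : expT v ∈ axisTube hr := by
  have harg : ∀ j, |v j| < r → arg ((Circle.exp (v j) : Circle) : ℂ) = v j := fun j hj ↦ by
    have h := abs_lt.1 (hj.trans_le hr)
    exact Circle.arg_exp h.1 h.2.le
  rw [mem_axisTube_iff]
  exact ⟨by show |arg ((Circle.exp (v 1) : Circle) : ℂ)| < r; rw [harg 1 h1]; exact h1,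
    by show |arg ((Circle.exp (v 2) : Circle) : ℂ)| < r; rw [harg 2 h2]; exact h2⟩

/-- A coordinate point with small last two coordinates is good. [folklore] -/
theorem tnGood_mtCoord {v : 𝔼 3} {s : ℝ} (hs0 : 0 < s) (hs1 : s < 3 / 2) (h1 : |v 1| < r) (h2 : |v 2| < r) :
    TNGood hr (mtCoord tubeShearDiffeo (v, s)) :=
  tnGood_mtPt hr hs0 hs1 fun _ ↦ expT_mem_axisTube_of hr h1 h2

/-- A point `[(z₁, e^{iy}, e^{iℓ}), t]` with `|y|, |ℓ| < r` is good. [folklore] -/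
theorem tnGood_mtPt_exp {z₁ : Circle} {y ℓ t : ℝ} (ht0 : 0 < t) (ht1 : t < 3 / 2) (hy : |y| < r) (hℓ : |ℓ| < r) :
    TNGood hr (mtPt tubeShearDiffeo (z₁, Circle.exp y, Circle.exp ℓ) t) := by
  refine tnGood_mtPt hr ht0 ht1 fun _ ↦ ?_
  have harg : ∀ x : ℝ, |x| < r → arg ((Circle.exp x : Circle) : ℂ) = x := fun x hx ↦ by
    have h := abs_lt.1 (hx.trans_le hr)
    exact Circle.arg_exp h.1 h.2.le
  rw [mem_axisTube_iff]
  exact ⟨by show |arg ((Circle.exp y : Circle) : ℂ)| < r; rw [harg y hy]; exact hy,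
    by show |arg ((Circle.exp ℓ : Circle) : ℂ)| < r; rw [harg ℓ hℓ]; exact hℓ⟩

include hε2 in
/-- **Tube points of the surgery are good** (for `ε ≤ r`). [folklore] -/
theorem tnGood_of_mem_range (hεr : ε ≤ r) {p : MTorus tubeShearDiffeo} (hp : p ∈ range (fishNu hε hε2).toFun) : TNGood hr p := by
  obtain ⟨⟨u, w⟩, rfl⟩ := hp
  set v := (TubeTwist.const ε hε (le_pi_of_le_half hε2)).shrink w with hv
  have hvn : ‖v‖ < ε := TubeTwist.norm_shrink_const_lt hε _ w
  intro a ha h12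
  rcases ne_ptA_or_ne_ptB u with hu | hu
  · rw [show (fishNu hε hε2).toFun (u, w) = _ from prodTube_apply_of_ne tubeShearDiffeo ε hε (le_pi_of_le_half hε2) (tubeShearDiffeo_expT hε2) hu w] at ha
    have := (mtGlueData tubeShearDiffeo).inl_injective ha
    rw [this]
    exact expT_mem_axisTube hr (hvn.trans_le hεr)
  · rw [show (fishNu hε hε2).toFun (u, w) = _ from prodTube_apply_of_ne_ptB tubeShearDiffeo ε hε (le_pi_of_le_half hε2) (tubeShearDiffeo_expT hε2) hu w,
      mappingTorusGlued_inl_eq_inr_iff, mappingTorusRel] at ha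
    have hb : 1 / 2 < ((angBPt u : ↥mappingTorusPieceTwo) : ℝ) ∧ ((angBPt u : ↥mappingTorusPieceTwo) : ℝ) < 3 / 2 := (angBPt u).2
    rcases ha with ⟨h1, -⟩ | ⟨h1, -⟩
    · rw [h12] at h1; linarith [hb.1]
    · rw [h12] at h1; linarith [hb.2]

/-- **A good-or-new tube point.** [folklore] -/
def TNPt (p : (fishNu hε hε2).Surgered) : Prop :=
  (∃ b, p = (fishNu hε hε2).glueData.inr b) ∨ ∃ m, p = toSurg (fishNu hε hε2) m ∧ TNGood hr m

variable {hr}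

/-- `TNPt hε hε2 hr (toSurg (fishNu hε hε2) (mtCoord tubeShearDiffeo (v, s)))`. [folklore] -/
theorem tnPt_mtCoord {v : 𝔼 3} {s : ℝ} (hs0 : 0 < s) (hs1 : s < 3 / 2) (h1 : |v 1| < r) (h2 : |v 2| < r) :
    TNPt hε hε2 hr (toSurg (fishNu hε hε2) (mtCoord tubeShearDiffeo (v, s))) :=
  Or.inr ⟨_, rfl, tnGood_mtCoord hr hs0 hs1 h1 h2⟩

/-- `TNPt hε hε2 hr p`. [folklore] -/
theorem tnPt_of_TLow {p : (fishNu hε hε2).Surgered} (h : TLow hε hε2 p) : TNPt hε hε2 hr p := by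
  obtain ⟨X, t, rfl, ht0, ht1⟩ := h
  rw [tH_eq] at ht1
  exact Or.inr ⟨_, rfl, tnGood_mtPt_of_lt hr ht0 (by linarith)⟩

/-- `TNPt hε hε2 hr p`. [folklore] -/
theorem tnPt_of_U3Pt {p : (fishNu hε hε2).Surgered} (h : U3Pt hε hε2 p) : TNPt hε hε2 hr p := by
  obtain ⟨X, t, y, rfl, ht0, ht1, -⟩ := h
  exact Or.inr ⟨_, rfl, tnGood_mtPt_of_lt hr ht0 (by linarith)⟩

/-! ### Offset bounds -/

include hε hε2 in
/-- `|κ(n) a| < ρ_b` for `0 ≤ n ≤ 1/2` and admissible `a`. [folklore] -/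
theorem abs_kap_mul_lt {n a : ℝ} (hn0 : 0 ≤ n) (hn1 : n ≤ 1 / 2) (ha : |a| < rhoB ε hε hε2) : |kap ε n * a| < rhoB ε hε hε2 ∨ a = 0 := by
  obtain ⟨hk1, hk2⟩ := kap_mem (ε := ε) n
  have hl := lam_le ε hε; have hl0 := lam_pos ε hε
  have hk0 : 0 ≤ kap ε n := le_trans (le_min hn0 hl0.le) hk1
  have hk3 : kap ε n ≤ 1 / 2 := hk2.trans (max_le hn1 (by linarith))
  by_cases h0 : a = 0
  · exact Or.inr h0
  · left
    rw [abs_mul, abs_of_nonneg hk0]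
    have := abs_pos.2 h0
    nlinarith

include hε hε2 in
/-- `|κ(n) a| < r` for `0 ≤ n ≤ 1/2`, admissible `a` and `ε ≤ r`. [folklore] -/
theorem abs_kap_mul_lt_r (hεr : ε ≤ r) {n a : ℝ} (hn0 : 0 ≤ n) (hn1 : n ≤ 1 / 2) (ha : |a| < rhoB ε hε hε2) : |kap ε n * a| < r := by
  have hρ := rhoB_le_eps hε hε2
  rcases abs_kap_mul_lt hε hε2 hn0 hn1 ha with h | h
  · linarith
  · rw [h, mul_zero, abs_zero]; linarith

include hε hε2 in
/-- `|λ a| < r` for admissible `a` and `ε ≤ r`. [folklore] -/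
theorem abs_lam_mul_lt_r (hεr : ε ≤ r) {a : ℝ} (ha : |a| < rhoB ε hε hε2) : |lam ε * a| < r := by
  have hl := lam_le ε hε; have hl0 := lam_pos ε hε
  have hρ := rhoB_le_eps hε hε2
  rw [abs_mul, abs_of_pos hl0]
  have : lam ε * |a| ≤ 1 * |a| := by nlinarith [abs_nonneg a]
  linarith

/-! ### The `D⁰` windows -/

include hε2 in
/-- **The south window is good.** [folklore] -/
theorem winS_tn (hεr : ε ≤ r) {q : ℂ × ℝ × ℝ} (hq : q.2 ∈ AdmP ε hε hε2) : TNPt hε hε2 hr ((fishT ε hε hε2).winS q) := by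
  obtain ⟨-, -, ha, hb, -⟩ := adm_bounds hε2 hq
  rw [TubeDData.winS, tubeD0S]
  by_cases h : ‖q.1‖ < 1 / 2
  · left; rw [glueBy_of_lt (τ := fun q : ℂ × ℝ × ℝ ↦ ‖q.1‖) h]; exact ⟨_, rfl⟩
  · rw [glueBy_of_le (τ := fun q : ℂ × ℝ × ℝ ↦ ‖q.1‖) (not_lt.1 h), pieceS2, polarForm_apply, zoneS2n_apply, scaleReal]
    have hbs := baseOf_mem' (exp (arg q.1 * I))
    have hn0 : 0 ≤ -capN ε q.1 := by
      by_cases h0 : q.1 = 0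
      · rw [h0, capN, norm_zero, capLat]; simp
      · exact (neg_capN_pos hε h0).le
    have hn1 : -capN ε q.1 ≤ 1 / 2 := by linarith [neg_capN_lt_eps hε q.1]
    refine tnPt_mtCoord hε hε2 hbs.1 hbs.2 ?_ ?_
    · simp only [show (fishT ε hε hε2).kapS = kap ε from rfl, show (fishT ε hε hε2).ε = ε from rfl]
      simpa using abs_kap_mul_lt_r hε hε2 hεr hn0 hn1 ha
    · simp only [show (fishT ε hε hε2).kapS = kap ε from rfl, show (fishT ε hε hε2).ε = ε from rfl]
      simpa [abs_neg] using abs_kap_mul_lt_r hε hε2 hεr hn0 hn1 hb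

include hε2 in
/-- **The flat-annulus window is good**: over `s = 1/2` the winding section vanishes. [folklore] -/
theorem winA_tn (hεr : ε ≤ r) {q : ℂ × ℝ × ℝ} (hq : q.2 ∈ AdmP ε hε hε2) (hn0 : 0 ≤ (fishT ε hε hε2).nfun ‖q.1‖) :
    TNPt hε hε2 hr ((fishT ε hε hε2).winA q) := by
  obtain ⟨-, -, ha, hb, -⟩ := adm_bounds hε2 hq
  set T := fishT ε hε hε2 with hT
  set n := T.nfun ‖q.1‖ with hn
  have hbs := baseOf_mem' (exp (arg q.1 * I))
  have hnA : T.nA = 33 * ε / 50 := rfl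
  rw [TubeDData.winA, radialForm_apply, tubeD0A]
  change TNPt hε hε2 hr (glue2 T.nA (pieceA2 T.hε T.hε2 T.kapS) (glue2 T.nB (pieceA3 T.hε T.hε2 T.lam T.μS) (pieceAM T.hε T.hε2 T.δ T.lam T.cut))
    (n, arg q.1, q.2))
  by_cases hA : n < T.nA
  · rw [glue2_of_lt hA, pieceA2, zoneS2_apply, scaleReal]
    have hn1 : n ≤ 1 / 2 := by rw [hnA] at hA; linarith
    refine tnPt_mtCoord hε hε2 hbs.1 hbs.2 ?_ ?_
    · simp only [show T.kapS = kap ε from rfl]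
      simpa using abs_kap_mul_lt_r hε hε2 hεr hn0 hn1 ha
    · simp only [show T.kapS = kap ε from rfl]
      simpa [abs_neg] using abs_kap_mul_lt_r hε hε2 hεr hn0 hn1 hb
  rw [glue2_of_le (not_lt.1 hA)]
  by_cases hB : n < T.nB
  · rw [glue2_of_lt hB, pieceA3, zoneS3_apply, switchXReal]
    refine tnPt_mtCoord hε hε2 hbs.1 hbs.2 ?_ ?_
    · simpa [show T.lam = lam ε from rfl] using abs_lam_mul_lt_r hε hε2 hεr ha
    · simpa [show T.lam = lam ε from rfl, abs_neg] using abs_lam_mul_lt_r hε hε2 hεr hb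
  · rw [glue2_of_le (not_lt.1 hB), pieceAM, zoneM_apply, midT3]
    simp only [show T.lam = lam ε from rfl]
    refine Or.inr ⟨_, rfl, tnGood_mtPt hr hbs.1 hbs.2 fun h12 ↦ ?_⟩
    rw [h12, midEll, sigmaFar_of_le (show (0:ℝ) < T.δ by show (0:ℝ) < 1 / 200; norm_num)
      (show (1:ℝ) / 2 ≤ 3 / 4 - T.δ by show (1:ℝ) / 2 ≤ 3 / 4 - 1 / 200; norm_num), zero_sub, mem_axisTube_iff]
    have harg : ∀ x : ℝ, |x| < r → arg ((Circle.exp x : Circle) : ℂ) = x := fun x hx ↦ by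
      have h := abs_lt.1 (hx.trans_le hr)
      exact Circle.arg_exp h.1 h.2.le
    have h1 := abs_lam_mul_lt_r hε hε2 hεr ha
    have h2 : |-(lam ε * q.2.2)| < r := by rw [abs_neg]; exact abs_lam_mul_lt_r hε hε2 hεr hb
    exact ⟨by show |arg ((Circle.exp (lam ε * q.2.1) : Circle) : ℂ)| < r; rw [harg _ h1]; exact h1,
      by show |arg ((Circle.exp (-(lam ε * q.2.2)) : Circle) : ℂ)| < r; rw [harg _ h2]; exact h2⟩

/-- **The cap section is `1` over `s = 1/2`**: the chart point `capPt ε n (1/2) = -capRad` is far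
from the puncture and past the step. [folklore] -/
theorem sigmaCapC_capPt_half {tj δ r₁ r₂ r₃ : ℝ} (htj : r₃ ≤ tj) (hδ : 0 < δ) (hδ' : δ ≤ 1 / 4) {n : ℝ} (hn : n ≤ 0) :
    sigmaCapC tj δ r₁ r₂ r₃ (capPt ε n (1 / 2)) = 1 := by
  have hd : capPt ε n (1 / 2) = -((capRad ε n : ℝ) : ℂ) := by
    rw [capPt, show (2 * π * (1 / 2 : ℝ) * I : ℂ) = π * I by push_cast; ring, Complex.exp_pi_mul_I]; ring
  have hR := capRad_nonneg (ε := ε) hn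
  rw [sigmaCapC, if_neg, sigmaOutC_eq_one_of_sStepD_eq_one]
  · rw [sStepD, hd]
    refine sStep_of_ge hδ ?_
    have harg : 0 ≤ arg (-((capRad ε n : ℝ) : ℂ)) := Complex.arg_nonneg_iff.2 (by simp)
    have : 0 ≤ arg (-((capRad ε n : ℝ) : ℂ)) / (2 * π) := div_nonneg harg (by positivity)
    linarith
  · rw [not_lt, hd, dCenter]
    calc r₃ ≤ tj := htj
      _ ≤ |(-((capRad ε n : ℝ) : ℂ) - -((tj : ℂ) * I)).im| := by simp [le_abs_self]
      _ ≤ ‖-((capRad ε n : ℝ) : ℂ) - -((tj : ℂ) * I)‖ := Complex.abs_im_le_norm _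

include hε2 in
/-- **The north window is good**: over `s = 1/2` the cap section is `1` and the winding section vanishes. [folklore] -/
theorem winN_tn (hεr : ε ≤ r) {q : ℂ × ℝ × ℝ} (hq : q.2 ∈ AdmP ε hε hε2) : TNPt hε hε2 hr ((fishT ε hε hε2).winN q) := by
  obtain ⟨-, -, ha, hb, -⟩ := adm_bounds hε2 hq
  set d : ℂ := (fishT ε hε hε2).tdisc (radMapW (fishT ε hε hε2).Pfun q).1 with hd
  have hTε : (fishT ε hε hε2).ε = ε := rfl
  have hTk : (fishT ε hε hε2).kapN = kap ε := rfl
  have hTl : (fishT ε hε hε2).lam = lam ε := rfl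
  have hbs := baseOf_mem' (exp (arg d * I))
  have hn0 : 0 ≤ -capN ε d := by
    by_cases h0 : d = 0
    · rw [h0, capN, norm_zero, capLat]; simp
    · exact (neg_capN_pos hε h0).le
  have hn1 : -capN ε d ≤ 1 / 2 := by linarith [neg_capN_lt_eps hε d]
  have harg : ∀ x : ℝ, |x| < r → arg ((Circle.exp x : Circle) : ℂ) = x := fun x hx ↦ by
    have h := abs_lt.1 (hx.trans_le hr)
    exact Circle.arg_exp h.1 h.2.le
  have hla := abs_lam_mul_lt_r hε hε2 hεr ha
  have hlb : |-(lam ε * q.2.2)| < r := by rw [abs_neg]; exact abs_lam_mul_lt_r hε hε2 hεr hb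
  rw [TubeDData.winN]
  change TNPt hε hε2 hr (tubeD0N (fishT ε hε hε2).hε (fishT ε hε hε2).hε2 (capTj (fishT ε hε hε2).ε (fishT ε hε hε2).nj) (fishT ε hε hε2).δ (fishT ε hε hε2).rσ₁ (fishT ε hε hε2).rσ₂ (fishT ε hε hε2).rσ₃ (fishT ε hε hε2).lam (fishT ε hε hε2).cN (fishT ε hε hε2).kapN (fishT ε hε hε2).μN (fishT ε hε hε2).cut (fishT ε hε hε2).RM (d, q.2))
  rw [tubeD0N]
  by_cases h1 : ‖d‖ < 1 / 2
  · left; rw [glueBy_of_lt (τ := fun q : ℂ × ℝ × ℝ ↦ ‖q.1‖) (by exact h1)]; exact ⟨_, rfl⟩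
  rw [glueBy_of_le (τ := fun q : ℂ × ℝ × ℝ ↦ ‖q.1‖) (not_lt.1 h1)]
  by_cases h2 : ‖d‖ < 13 / 20
  · rw [glueBy_of_lt (τ := fun q : ℂ × ℝ × ℝ ↦ ‖q.1‖) (by exact h2), pieceN2, polarForm_apply, zoneN2_apply, scaleRealN_apply]
    dsimp only
    refine tnPt_mtCoord hε hε2 hbs.1 hbs.2 ?_ ?_
    · simp only [hTk, hTε]
      simpa using abs_kap_mul_lt_r hε hε2 hεr hn0 hn1 ha
    · simp only [hTk, hTε]
      simpa [abs_neg] using abs_kap_mul_lt_r hε hε2 hεr hn0 hn1 hb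
  rw [glueBy_of_le (τ := fun q : ℂ × ℝ × ℝ ↦ ‖q.1‖) (not_lt.1 h2)]
  by_cases h3 : ‖d‖ < 4 / 5
  · rw [glueBy_of_lt (τ := fun q : ℂ × ℝ × ℝ ↦ ‖q.1‖) (by exact h3), pieceN3, polarForm_apply, zoneN3_apply]
    dsimp only
    have hform : ∀ (μ : ℝ → ℝ) (k n s : ℝ) (w : ℝ × ℝ), switchXRealN μ k (n, s, w) = mirrorL (switchXReal μ k (n, s, w.1, -w.2)) :=
      fun _ _ _ _ _ ↦ rfl
    rw [hform, switchXReal, mirrorL_apply]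
    refine tnPt_mtCoord hε hε2 hbs.1 hbs.2 ?_ ?_
    · simpa [hTl] using hla
    · simpa [hTl, abs_neg] using abs_lam_mul_lt_r hε hε2 hεr hb
  rw [glueBy_of_le (τ := fun q : ℂ × ℝ × ℝ ↦ ‖q.1‖) (not_lt.1 h3)]
  have hδ0 : (0:ℝ) < (fishT ε hε hε2).δ := by show (0:ℝ) < 1 / 200; norm_num
  have hδ1 : (fishT ε hε hε2).δ ≤ 1 / 4 := by show (1:ℝ) / 200 ≤ 1 / 4; norm_num
  by_cases h4 : ‖d‖ < (fishT ε hε hε2).RM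
  · rw [glueBy_of_lt (τ := fun q : ℂ × ℝ × ℝ ↦ ‖q.1‖) (by exact h4), pieceN4, polarForm_apply, zoneN4_apply, northT3]
    dsimp only
    refine Or.inr ⟨_, rfl, tnGood_mtPt hr hbs.1 hbs.2 fun h12 ↦ ?_⟩
    have htj : (fishT ε hε hε2).rσ₃ ≤ capTj ε (fishT ε hε hε2).nj := by
      show (3:ℝ) / 10 ≤ capTj ε (nj ε)
      linarith [(capTj_bounds ε hε).1]
    have hσ : sigmaCapC (capTj ε (fishT ε hε hε2).nj) (fishT ε hε hε2).δ (fishT ε hε hε2).rσ₁ (fishT ε hε hε2).rσ₂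
        (fishT ε hε hε2).rσ₃ (capPt ε (capN ε d) (1 / 2)) = 1 :=
      sigmaCapC_capPt_half htj hδ0 hδ1 (by linarith)
    rw [h12, northZ3, hTε, hσ, one_mul, hTl, mem_axisTube_iff]
    exact ⟨by show |arg ((Circle.exp (lam ε * q.2.1) : Circle) : ℂ)| < r; rw [harg _ hla]; exact hla,
      by show |arg ((Circle.exp (-(lam ε * q.2.2)) : Circle) : ℂ)| < r; rw [harg _ hlb]; exact hlb⟩
  · rw [glueBy_of_le (τ := fun q : ℂ × ℝ × ℝ ↦ ‖q.1‖) (not_lt.1 h4), pieceM, polarForm_apply, zoneM_apply, midT3]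
    dsimp only
    refine Or.inr ⟨_, rfl, tnGood_mtPt hr hbs.1 hbs.2 fun h12 ↦ ?_⟩
    rw [h12, midEll, sigmaFar_of_le hδ0 (by linarith), zero_sub, hTl, mem_axisTube_iff]
    exact ⟨by show |arg ((Circle.exp (lam ε * q.2.1) : Circle) : ℂ)| < r; rw [harg _ hla]; exact hla,
      by show |arg ((Circle.exp (-(lam ε * q.2.2)) : Circle) : ℂ)| < r; rw [harg _ hlb]; exact hlb⟩

/-! ### The cap windows `U5`, `U4`: bases in `(1/2, 1)` -/

include hε2 in
/-- **U5 is good** (its base is in `(1/2, 1)`). [folklore] -/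
theorem winU5_tn {q : ℂ × ℝ × ℝ} (hq : q.2 ∈ AdmP ε hε hε2) (h1 : s3 ε - 1 / 10 < ‖q.1‖) (h2 : ‖q.1‖ < s4 ε) :
    TNPt hε hε2 hr ((fishT ε hε hε2).winU5 q) := by
  obtain ⟨hs, -, ha, hb, -⟩ := adm_bounds hε2 hq
  have hρ := ρA_pos; have hρv : ρA = 1 / 20 := rfl
  have hl := lam_le ε hε; have hl0 := lam_pos ε hε; have hρB := rhoB_le hε hε2
  have hπ := Real.pi_pos
  obtain ⟨hα1, hα2⟩ := alpha_winU5 (ε := ε) (r := ‖q.1‖) h1 (by linarith)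
  set α := angleUp (rzero ε) ‖q.1‖ with hα
  have hla : |lam ε * q.2.1| < ρA := by rw [abs_mul, abs_of_pos hl0]; nlinarith [abs_nonneg q.2.1]
  rw [TubeDData.winU5, radialForm_apply]
  show TNPt hε hε2 hr (pieceU5 _ _ (nj ε) ρA (α, arg q.1, lam ε * q.2.1, lam ε * q.2.2))
  rw [pieceU5, shellTubeMap, profTubeMap, profTube, dchartX, aConv]
  simp only
  obtain ⟨⟨hXf, hXb', hX2⟩, -, -⟩ := pathShell_offset hρ hα1.le (by linarith) hla
  have hXb : (pathShell ρA (α, lam ε * q.2.1)).1 ≤ 1 / 4 := by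
    rcases lt_or_ge α (π / 6) with hlt | hge
    · have hfl : flatU ρA α ≤ 4 * ρA := by
        rw [flatU]
        have := tan_le_tan_of_le (by linarith) hα1.le (by linarith)
        rw [Real.tan_neg, Real.tan_pi_div_four] at this; nlinarith
      linarith [hXf hlt, hla.le]
    · linarith [hXb' hge, hla.le]
  have hX0 : 0 ≤ (pathShell ρA (α, lam ε * q.2.1)).1 := by linarith [hla.le]
  have hP : ‖(((pathShell ρA (α, lam ε * q.2.1)).1 : ℝ) : ℂ) * exp (arg q.1 * I)‖ ≤ 3 / 10 := by
    rw [norm_mul, Complex.norm_exp_ofReal_mul_I, mul_one, Complex.norm_real, Real.norm_eq_abs, abs_of_nonneg hX0]; linarith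
  obtain ⟨hS1, hS2⟩ := capS_chart_mem hε hP
  exact Or.inr ⟨_, rfl, tnGood_mtPt_of_lt hr hS1 (by linarith)⟩

include hε2 in
/-- **U4 is good** (its base is in `(1/2, 1)`). [folklore] -/
theorem winU4_tn {q : ℂ × ℝ × ℝ} (hq : q.2 ∈ AdmP ε hε hε2) :
    TNPt hε hε2 hr ((fishT ε hε hε2).winU4 q) := by
  obtain ⟨hs, -, ha, hb, -⟩ := adm_bounds hε2 hq
  have hρ := ρA_pos; have hρv : ρA = 1 / 20 := rfl
  have hl := lam_le ε hε; have hl0 := lam_pos ε hε; have hρB := rhoB_le hε hε2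
  set y := footY ρA (angleUp (rzero ε) ‖q.1‖) with hy
  have hla : |lam ε * q.2.1| ≤ 1 / 20 := by rw [abs_mul, abs_of_pos hl0]; nlinarith [abs_nonneg q.2.1]
  have hlb : |lam ε * q.2.2| ≤ 1 / 20 := by rw [abs_mul, abs_of_pos hl0]; nlinarith [abs_nonneg q.2.2]
  rw [TubeDData.winU4, radialForm_apply]
  show TNPt hε hε2 hr (pieceU4 _ _ (nj ε) ρA (y, arg q.1, lam ε * q.2.1, lam ε * q.2.2))
  rw [pieceU4, tubeUpMap, tubeUp, dchartX, aConv]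
  simp only
  have hu := uU_mem hρ y
  obtain ⟨hK0, hK1⟩ := footKc_mem hρ y
  have hχ := chiU_mem (ρ := ρA) y
  have hP : ‖((((uU ρA y + lam ε * q.2.1 * footKc ρA y : ℝ) : ℂ) + (((1 - chiU ρA y) * (lam ε * q.2.2) : ℝ) : ℂ) * I) *
      exp (arg q.1 * I))‖ ≤ 3 / 10 := by
    rw [norm_mul, Complex.norm_exp_ofReal_mul_I, mul_one]
    refine (norm_add_le _ _).trans ?_
    rw [norm_mul, Complex.norm_I, mul_one, Complex.norm_real, Complex.norm_real, Real.norm_eq_abs, Real.norm_eq_abs]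
    have h1' : |uU ρA y + lam ε * q.2.1 * footKc ρA y| ≤ 3 / 20 := by
      rw [abs_le]; constructor <;> nlinarith [hu.1, hu.2, abs_le.1 hla, hK0, hK1, abs_nonneg (lam ε * q.2.1)]
    have h2' : |(1 - chiU ρA y) * (lam ε * q.2.2)| ≤ 1 / 20 := by
      rw [abs_mul, abs_of_nonneg (by linarith [hχ.2])]; nlinarith [hχ.1, abs_nonneg (lam ε * q.2.2)]
    linarith
  obtain ⟨hS1, hS2⟩ := capS_chart_mem hε hP
  exact Or.inr ⟨_, rfl, tnGood_mtPt_of_lt hr hS1 (by linarith)⟩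

/-! ### All hole points -/

include hε2 in
/-- **Every hole point is new or good** for the twisted cylinder neighbourhood
`twistNbhd ψ 1 (axisTube r)`, `ε ≤ r`. [folklore] -/
theorem hole_tn (hεr : ε ≤ r) {q : ℂ × ℝ × ℝ} (hq : q.2 ∈ AdmP ε hε hε2) (hrr : ‖q.1‖ < cL ε hε hε2 * rhJ ε hε hε2) :
    TNPt hε hε2 hr ((fishT ε hε hε2).tubeD q) := by
  set T := fishT ε hε hε2 with hT
  obtain ⟨w12, w23, w34, w45, w56, w67, -⟩ := windows hε hε2
  obtain ⟨-, w3r⟩ := s2_lt_s3 hε hε2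
  have e1 : T.s₁ = 3 / 4 := rfl
  have e2 : T.s₂ = s2 ε := rfl
  have e3 : T.s₃ = s3 ε := rfl
  have e4 : T.s₄ = s4 ε := rfl
  have e5 : T.s₅ = s5 ε := rfl
  have e6 : T.s₆ = s6 ε := rfl
  have e7 : T.s₇ = s7 ε := rfl
  rw [TubeDData.tubeD, e1, e2, e3, e4, e5, e6, e7]
  by_cases h1 : ‖q.1‖ < 3 / 4
  · rw [glueBy_of_lt (τ := fun q : ℂ × ℝ × ℝ ↦ ‖q.1‖) (by exact h1)]
    exact winS_tn hε hε2 hεr hq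
  rw [glueBy_of_le (τ := fun q : ℂ × ℝ × ℝ ↦ ‖q.1‖) (not_lt.1 h1)]
  by_cases h2 : ‖q.1‖ < s2 ε
  · rw [glueBy_of_lt (τ := fun q : ℂ × ℝ × ℝ ↦ ‖q.1‖) (by exact h2)]
    refine winA_tn hε hε2 hεr hq ?_
    exact (nfun_pos hε hε2 (c := cL ε hε hε2) (ρb := rhoB ε hε hε2) (μ := muL ε) (by linarith) (by linarith)).le
  rw [glueBy_of_le (τ := fun q : ℂ × ℝ × ℝ ↦ ‖q.1‖) (not_lt.1 h2)]
  by_cases h3 : ‖q.1‖ < s3 ε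
  · rw [glueBy_of_lt (τ := fun q : ℂ × ℝ × ℝ ↦ ‖q.1‖) (by exact h3)]
    exact winN_tn hε hε2 hεr hq
  rw [glueBy_of_le (τ := fun q : ℂ × ℝ × ℝ ↦ ‖q.1‖) (not_lt.1 h3)]
  by_cases h4 : ‖q.1‖ < s4 ε
  · rw [glueBy_of_lt (τ := fun q : ℂ × ℝ × ℝ ↦ ‖q.1‖) (by exact h4)]
    exact winU5_tn hε hε2 hq (by linarith) h4
  rw [glueBy_of_le (τ := fun q : ℂ × ℝ × ℝ ↦ ‖q.1‖) (not_lt.1 h4)]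
  by_cases h5 : ‖q.1‖ < s5 ε
  · rw [glueBy_of_lt (τ := fun q : ℂ × ℝ × ℝ ↦ ‖q.1‖) (by exact h5)]
    exact winU4_tn hε hε2 hq
  rw [glueBy_of_le (τ := fun q : ℂ × ℝ × ℝ ↦ ‖q.1‖) (not_lt.1 h5)]
  by_cases h6 : ‖q.1‖ < s6 ε
  · rw [glueBy_of_lt (τ := fun q : ℂ × ℝ × ℝ ↦ ‖q.1‖) (by exact h6)]
    exact tnPt_of_U3Pt hε hε2 (winU3_taxonomy hε hε2 hq (not_lt.1 h5) h6)
  rw [glueBy_of_le (τ := fun q : ℂ × ℝ × ℝ ↦ ‖q.1‖) (not_lt.1 h6)]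
  by_cases h7 : ‖q.1‖ < s7 ε
  · rw [glueBy_of_lt (τ := fun q : ℂ × ℝ × ℝ ↦ ‖q.1‖) (by exact h7)]
    exact tnPt_of_TLow hε hε2 (winU2_taxonomy hε hε2 hq (not_lt.1 h6) h7)
  · rw [glueBy_of_le (τ := fun q : ℂ × ℝ × ℝ ↦ ‖q.1‖) (not_lt.1 h7)]
    exact tnPt_of_TLow hε hε2 (winU1_taxonomy hε hε2 hq (not_lt.1 h7) hrr)

end FP

end Literature.Topology.FourManifolds
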